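import Literature.AlgebraicGeometry.Resolution.PowerSeriesRegularLocal
import Mathlib.RingTheory.MvPowerSeries.Substitution
import Mathlib.RingTheory.MvPowerSeries.Trunc
import Mathlib.RingTheory.MvPowerSeries.Order
import Mathlib.RingTheory.PowerSeries.Derivative
import Mathlib.Algebra.MvPolynomial.PDeriv
import HarnessLib

/-!
# The chain rule for the partial derivatives `MvPowerSeries.pderiv` under substitution
(proofs only)

Topic `Literature/AlgebraicGeometry/Resolution`, next to `PowerSeriesRegularLocal.lean` whose
derivation `MvPowerSeries.pderiv i = ∂/∂Xᵢ` of `R⟦X⟧` it extends (that file lists "the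
compatibility of `MvPowerSeries.pderiv` with `MvPolynomial.pderiv`" as not done; it is
`MvPowerSeries.pderiv_coe` below). Written for the formal-group calculus of Silverman, *AEC*
IV.4–IV.5 (the invariant differential `ω = F_X(0, T)⁻¹ dT` is obtained by differentiating the
associativity law `F(U, F(T, S)) = F(F(U, T), S)` with respect to `U` "using the chain rule!",
AEC IV.4.2), which Mathlib (v4.32) has in one variable only (`PowerSeries.derivative_subst`).
No definitions.

* `MvPowerSeries.pderiv_coe` (`∂ᵢ` extends `MvPolynomial.pderiv`), `MvPowerSeries.pderiv_C`,
  `MvPowerSeries.coeff_eq_zero_of_pderiv_eq_zero` (over an additively torsion-free ring,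
  `∂ᵢ f = 0` kills every coefficient of positive `Xᵢ`-degree).
* **Chain rule** `MvPowerSeries.pderiv_subst`: for a finite family `a : τ → R⟦σ⟧` without
  constant terms and `f ∈ R⟦τ⟧`, `∂ᵢ (f(a)) = Σₜ (∂ₜ f)(a) · ∂ᵢ (aₜ)` (Bourbaki, *Algèbre* IV §4
  no. 5; proved on polynomials by induction, `MvPowerSeries.pderiv_aeval`, and extended by
  truncation — each coefficient of both sides depends on finitely many coefficients of `f`,
  `MvPowerSeries.coeff_subst_congr`), with the corollaries `MvPowerSeries.pderiv_subst_pair`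
  (the shape of `FormalGroup.assoc`), `MvPowerSeries.pderiv_powerSeries_subst`
  (`∂ᵢ (g(A)) = g'(A) · ∂ᵢ A`) and `MvPowerSeries.pderiv_toMvPowerSeries`.

## References

* N. Bourbaki, *Algèbre*, Ch. IV §4 (dérivations de séries formelles).
* J. H. Silverman, *The Arithmetic of Elliptic Curves*, 2nd ed. (2009), IV.4.2 (`SilvermanAEC2009`).
-/

noncomputable section

open MvPowerSeries Finsupp

namespace Literature.AlgebraicGeometry.Resolution

variable {σ : Type*} {R : Type*} [CommRing R]

/-! ### `∂ᵢ` on polynomials, constants, and the kernel of `∂ᵢ` -/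

/-- **`∂ᵢ` extends `MvPolynomial.pderiv i`** (the compatibility left open in
`PowerSeriesRegularLocal.lean`). [folklore] -/
theorem MvPowerSeries.pderiv_coe (i : σ) (p : MvPolynomial σ R) :
    MvPowerSeries.pderiv i (p : MvPowerSeries σ R) = (MvPolynomial.pderiv i p : MvPolynomial σ R) := by
  ext e
  rw [MvPowerSeries.coeff_pderiv, MvPolynomial.coeff_coe, MvPolynomial.coeff_coe,
    MvPolynomial.coeff_pderiv, mul_comm]

/-- `∂ᵢ (C c) = 0`. [folklore] -/
@[simp] theorem MvPowerSeries.pderiv_C (i : σ) (c : R) :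
    MvPowerSeries.pderiv i (C c : MvPowerSeries σ R) = 0 := by
  rw [← MvPolynomial.coe_C, MvPowerSeries.pderiv_coe, MvPolynomial.pderiv_C, MvPolynomial.coe_zero]

/-- **`∂ᵢ f = 0` forces the coefficients of positive `Xᵢ`-degree to vanish** (over an additively
torsion-free ring, e.g. a `ℚ`-algebra): the formal "a series with zero derivative is constant in
that variable". [folklore] -/
theorem MvPowerSeries.coeff_eq_zero_of_pderiv_eq_zero [IsAddTorsionFree R] {i : σ}
    {f : MvPowerSeries σ R} (h : MvPowerSeries.pderiv i f = 0) {e : σ →₀ ℕ} (he : e i ≠ 0) :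
    coeff e f = 0 := by
  classical
  set e' := e - single i 1 with he'
  have hee : e' + single i 1 = e := by
    rw [he']
    exact tsub_add_cancel_of_le (single_le_iff.mpr (Nat.one_le_iff_ne_zero.mpr he))
  have hc := congrArg (coeff e') h
  rw [MvPowerSeries.coeff_pderiv, map_zero, hee] at hc
  have hc' : (e' i + 1) • coeff e f = (e' i + 1) • (0 : R) := by
    rw [smul_zero, nsmul_eq_mul, Nat.cast_succ]
    exact hc
  exact nsmul_right_injective (Nat.succ_ne_zero _) hc'

/-! ### The chain rule -/

section ChainRule

variable {τ : Type*} {a : τ → MvPowerSeries σ R}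

/-- **Chain rule on polynomials**: `∂ᵢ (p(a)) = Σₜ (∂ₜ p)(a) · ∂ᵢ aₜ` for `p ∈ R[τ]` and any family
`a : τ → R⟦σ⟧` (induction on `p`). [Bourbaki, Algèbre IV §4 no. 5] [folklore] -/
theorem MvPowerSeries.pderiv_aeval [Fintype τ] (i : σ) (p : MvPolynomial τ R) :
    MvPowerSeries.pderiv i (MvPolynomial.aeval a p) =
      ∑ t, MvPolynomial.aeval a (MvPolynomial.pderiv t p) * MvPowerSeries.pderiv i (a t) := by
  classical
  induction p using MvPolynomial.induction_on with
  | C r =>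
    rw [MvPolynomial.aeval_C, MvPowerSeries.algebraMap_apply, Algebra.algebraMap_self, RingHom.id_apply,
      MvPowerSeries.pderiv_C]
    simp
  | add p q hp hq =>
    simp only [map_add, hp, hq, add_mul, Finset.sum_add_distrib]
  | mul_X p t₀ hp =>
    have hX : ∀ x, MvPolynomial.aeval a (MvPolynomial.pderiv x (MvPolynomial.X t₀ : MvPolynomial τ R)) =
        if t₀ = x then (1 : MvPowerSeries σ R) else 0 := fun x => by
      rw [MvPolynomial.pderiv_X, Pi.single_apply]
      split_ifs <;> simp
    have hsum : ∑ x, MvPolynomial.aeval a (MvPolynomial.pderiv x (p * MvPolynomial.X t₀)) *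
        MvPowerSeries.pderiv i (a x) =
        ∑ x, ((if t₀ = x then (1 : MvPowerSeries σ R) else 0) *
            (MvPolynomial.aeval a p * MvPowerSeries.pderiv i (a x)) +
          a t₀ * (MvPolynomial.aeval a (MvPolynomial.pderiv x p) * MvPowerSeries.pderiv i (a x))) := by
      refine Finset.sum_congr rfl fun x _ => ?_
      rw [Derivation.leibniz, smul_eq_mul, smul_eq_mul, map_add, map_mul, map_mul, hX,
        MvPolynomial.aeval_X]
      ring
    rw [map_mul, MvPolynomial.aeval_X, Derivation.leibniz, smul_eq_mul, smul_eq_mul, hp, hsum,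
      Finset.sum_add_distrib, ← Finset.mul_sum]
    congr 1
    simp only [ite_mul, one_mul, zero_mul, Finset.sum_ite_eq, Finset.mem_univ, if_true]

/-- `∏ₜ aₜ^{d t}` has order at least `|d|` when the `aₜ` have no constant terms. [folklore] -/
theorem MvPowerSeries.degree_le_order_prod_pow (ha : ∀ t, constantCoeff (a t) = 0) (d : τ →₀ ℕ) :
    ((Finsupp.degree d : ℕ) : ℕ∞) ≤ order (d.prod fun t n => a t ^ n) := by
  classical
  unfold Finsupp.prod
  refine le_trans ?_ (le_order_prod _ _)
  rw [Finsupp.degree_apply, Nat.cast_sum]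
  refine Finset.sum_le_sum fun t _ => le_trans ?_ (le_order_pow _)
  calc ((d t : ℕ) : ℕ∞) = d t • (1 : ℕ∞) := by simp
    _ ≤ d t • order (a t) :=
        nsmul_le_nsmul_right (MvPowerSeries.one_le_order_iff_constCoeff_eq_zero.mpr (ha t)) _

/-- **Locality of substitution**: the `e`-th coefficient of `g(a)` only depends on the
coefficients of `g` of degree `≤ |e|` (for `a` without constant terms). [Bourbaki, Algèbre IV §4
no. 3] [folklore] -/
theorem MvPowerSeries.coeff_subst_congr [Finite τ] (ha : ∀ t, constantCoeff (a t) = 0)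
    {g g' : MvPowerSeries τ R} {e : σ →₀ ℕ}
    (h : ∀ d : τ →₀ ℕ, Finsupp.degree d ≤ Finsupp.degree e → coeff d g = coeff d g') :
    coeff e (subst a g) = coeff e (subst a g') := by
  have hs : HasSubst a := hasSubst_of_constantCoeff_zero ha
  rw [coeff_subst hs, coeff_subst hs]
  refine finsum_congr fun d => ?_
  by_cases hd : Finsupp.degree d ≤ Finsupp.degree e
  · rw [h d hd]
  · have h0 : coeff e (d.prod fun t n => a t ^ n) = 0 := by
      apply coeff_of_lt_order
      refine lt_of_lt_of_le ?_ (MvPowerSeries.degree_le_order_prod_pow ha d)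
      exact_mod_cast (not_le.mp hd)
    rw [h0, smul_zero, smul_zero]

/-- Truncating `f` in total degree `n` does not change its coefficients of degree `< n`
(`MvPowerSeries.coeff_truncTotal`, series form). [folklore] -/
theorem MvPowerSeries.coeff_coe_truncTotal_of_lt [Finite τ] (f : MvPowerSeries τ R) {n : ℕ}
    {d : τ →₀ ℕ} (hd : Finsupp.degree d < n) :
    coeff d (truncTotal n f : MvPowerSeries τ R) = coeff d f := by
  rw [MvPolynomial.coeff_coe]
  exact coeff_truncTotal f hd

/-- **Chain rule for substitution** (Bourbaki, *Algèbre* IV §4 no. 5, Prop. 7): for a finite family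
`a : τ → R⟦σ⟧` of series without constant terms and `f ∈ R⟦τ⟧`,
`∂ᵢ (f(a)) = Σₜ (∂ₜ f)(a) · ∂ᵢ (aₜ)` — proved on polynomials (`pderiv_aeval`) and extended by
truncation. [folklore] -/
theorem MvPowerSeries.pderiv_subst [Fintype τ] (ha : ∀ t, constantCoeff (a t) = 0) (i : σ)
    (f : MvPowerSeries τ R) :
    MvPowerSeries.pderiv i (subst a f) =
      ∑ t, subst a (MvPowerSeries.pderiv t f) * MvPowerSeries.pderiv i (a t) := by
  classical
  ext e
  set n := Finsupp.degree e + 2 with hn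
  set p : MvPolynomial τ R := truncTotal n f with hp
  -- `f` and its truncation agree in degrees `≤ |e| + 1`
  have hagree : ∀ d : τ →₀ ℕ, Finsupp.degree d ≤ Finsupp.degree e + 1 →
      coeff d (p : MvPowerSeries τ R) = coeff d f := fun d hd =>
    MvPowerSeries.coeff_coe_truncTotal_of_lt f (by omega)
  -- left-hand side through the truncation
  have hL : coeff e (MvPowerSeries.pderiv i (subst a f)) =
      coeff e (MvPowerSeries.pderiv i (subst a (p : MvPowerSeries τ R))) := by
    rw [MvPowerSeries.coeff_pderiv, MvPowerSeries.coeff_pderiv,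
      MvPowerSeries.coeff_subst_congr ha (g := f) (g' := (p : MvPowerSeries τ R))]
    intro d hd
    rw [hagree d (by rw [map_add, Finsupp.degree_single] at hd; omega)]
  -- right-hand side through the truncation
  have hR : ∀ t, coeff e (subst a (MvPowerSeries.pderiv t f) * MvPowerSeries.pderiv i (a t)) =
      coeff e (subst a (MvPowerSeries.pderiv t (p : MvPowerSeries τ R)) * MvPowerSeries.pderiv i (a t)) := by
    intro t
    rw [coeff_mul, coeff_mul]
    refine Finset.sum_congr rfl fun x hx => ?_
    have hx' : x.1 + x.2 = e := Finset.mem_antidiagonal.mp hx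
    have hx1 : Finsupp.degree x.1 ≤ Finsupp.degree e := by
      rw [← hx', map_add]; exact Nat.le_add_right _ _
    congr 1
    refine MvPowerSeries.coeff_subst_congr ha fun d hd => ?_
    rw [MvPowerSeries.coeff_pderiv, MvPowerSeries.coeff_pderiv, hagree (d + single t 1) ?_]
    rw [map_add, Finsupp.degree_single]; omega
  rw [hL, map_sum, Finset.sum_congr rfl fun t _ => hR t, ← map_sum, subst_coe,
    MvPowerSeries.pderiv_aeval]
  congr 1
  refine Finset.sum_congr rfl fun t _ => ?_
  rw [MvPowerSeries.pderiv_coe, subst_coe]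

/-- **Chain rule for a pair**: `∂ᵢ (f(A, B)) = (∂₀f)(A, B) · ∂ᵢ A + (∂₁f)(A, B) · ∂ᵢ B` for
`f ∈ R⟦X₀, X₁⟧` and `A, B ∈ R⟦σ⟧` without constant terms (the shape of the `assoc` field of
Mathlib's `FormalGroup`; AEC IV.4.2: "differentiate the associative law … with respect to `U`").
[Silverman AEC IV.4.2, proof] [folklore] -/
theorem MvPowerSeries.pderiv_subst_pair {A B : MvPowerSeries σ R} (hA : constantCoeff A = 0)
    (hB : constantCoeff B = 0) (i : σ) (f : MvPowerSeries (Fin 2) R) :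
    MvPowerSeries.pderiv i (subst ![A, B] f) =
      subst ![A, B] (MvPowerSeries.pderiv 0 f) * MvPowerSeries.pderiv i A +
        subst ![A, B] (MvPowerSeries.pderiv 1 f) * MvPowerSeries.pderiv i B := by
  have h : ∀ t : Fin 2, constantCoeff ((![A, B]) t) = 0 := fun t => by fin_cases t <;> assumption
  rw [MvPowerSeries.pderiv_subst h, Fin.sum_univ_two]
  rfl

/-- On `R⟦X⟧ = R⟦Unit⟧` the partial derivative is Mathlib's `PowerSeries.derivative`. [folklore] -/
theorem MvPowerSeries.pderiv_unit_eq_derivative (g : PowerSeries R) :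
    MvPowerSeries.pderiv (default : Unit) g = PowerSeries.derivative R g := by
  ext n
  show MvPowerSeries.coeff (single () n) (MvPowerSeries.pderiv () g) =
    PowerSeries.coeff n (PowerSeries.derivative R g)
  rw [MvPowerSeries.coeff_pderiv, PowerSeries.coeff_derivative, ← Finsupp.single_add,
    Finsupp.single_eq_same, mul_comm]
  rfl

/-- **Chain rule, one outer variable**: `∂ᵢ (g(A)) = g'(A) · ∂ᵢ A` for `g ∈ R⟦X⟧` and `A ∈ R⟦σ⟧`
without constant term. [Bourbaki, Algèbre IV §4 no. 5] [folklore] -/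
theorem MvPowerSeries.pderiv_powerSeries_subst {A : MvPowerSeries σ R} (hA : constantCoeff A = 0)
    (i : σ) (g : PowerSeries R) :
    MvPowerSeries.pderiv i (g.subst A) = (PowerSeries.derivative R g).subst A * MvPowerSeries.pderiv i A := by
  rw [PowerSeries.subst_def, MvPowerSeries.pderiv_subst (fun _ => hA), Fintype.sum_unique,
    PowerSeries.subst_def, ← MvPowerSeries.pderiv_unit_eq_derivative]

/-- A one-variable series read in the variable `Xⱼ`: `∂ᵢ (g(Xⱼ)) = δᵢⱼ · g'(Xⱼ)`. [folklore] -/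
theorem MvPowerSeries.pderiv_toMvPowerSeries [DecidableEq σ] (i j : σ) (g : PowerSeries R) :
    MvPowerSeries.pderiv i (g.toMvPowerSeries j) =
      if j = i then (PowerSeries.derivative R g).toMvPowerSeries j else 0 := by
  rw [PowerSeries.toMvPowerSeries_eq_subst, MvPowerSeries.pderiv_powerSeries_subst (constantCoeff_X j),
    MvPowerSeries.pderiv_X, PowerSeries.toMvPowerSeries_eq_subst]
  split_ifs <;> simp

/-- The same for `g.subst Xⱼ` (the form used in `FormalGroupLaw.lean`). [folklore] -/
theorem MvPowerSeries.pderiv_powerSeries_subst_X [DecidableEq σ] (i j : σ) (g : PowerSeries R) :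
    MvPowerSeries.pderiv i (g.subst (X j : MvPowerSeries σ R)) =
      if j = i then (PowerSeries.derivative R g).subst (X j : MvPowerSeries σ R) else 0 := by
  rw [MvPowerSeries.pderiv_powerSeries_subst (constantCoeff_X j), MvPowerSeries.pderiv_X]
  split_ifs <;> simp

end ChainRule

end Literature.AlgebraicGeometry.Resolution
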